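import Summits.ValiantsHypothesis.ValiantsHypothesis.Theorems.LacunarySymmetroidMatrixDescartesRobustDescartes
import Summits.ValiantsHypothesis.ValiantsHypothesis.Theorems.LacunarySymmetroidMatrixDescartesLowRankSector

/-!
# `MatrixDescartes` — the OVERLAP WINDOW LAW: a window pays only for the monomials of its live sub-pencil

HONEST FRAMING.  Object-search cell `pub-symmetroid`, crux `Theses.LacunarySymmetroid.MatrixDescartes` (ledger item
`stmt-ValiantsHypothesis-18050`, route `LacunarySymmetroid`; seat `val-sym-mdr-p2`, gen 13).  The crux implies `VP ≠ VNP`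
by the route's assembly; NOTHING here is progress on it, and nothing here is a claim about `VP ≠ VNP`, `DoorA26` /
`DoorA34` or the cell's registers.  A MAGNITUDE-HYPOTHESIS law for real lacunary pencils `F = ∑ₗ X^(d l) • S l` with
ARBITRARY real `m × m` letters (no symmetry, rank, commutation or definiteness hypothesis), in the OVERLAP regime left open
by the letter-separated sector (`…SeparatedSector`, gen 12: at most TWO letters live at a time).

THE LAW (`card_roots_Icc_le_of_liveSet`).  Fix a window `[u, v] ⊂ (0, ∞)`, a LIVE SET `L` of letters and a SURVIVOR letter
`t ∈ L` whose exponent is extreme in `L` (strictly largest, or strictly smallest).  By the row-choice expansion (tree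
`LowRankSector.det_pencil_eq_sum_rowChoice`) `det F = ∑_f X^(e f)·det N_f` over row-to-letter maps `f : Fin m → Fin K`
(`e f = ∑ᵢ d (f i)`, `N_f` = row `i` taken from `S (f i)`); the LIVE EXPONENT SET `E_L = {e f : f live}` has at most
`C(#L + m − 1, m)` elements (count vectors, `card_liveExps_le`), and `m·d t ∈ E_L` is the exponent of the single live map
`f ≡ t` (`eq_const_of_sum_eq_top/bot`).  Cut at every element of `E_L` except `m·d t` (robust Descartes rule, tree
`RobustDescartes.card_roots_Icc_le_card_cuts`): every live monomial except the survivor `det(S t)·X^(m·d t)` is killed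
EXACTLY, whatever its coefficient, and the cut determinant is zero-free on `[u, v]` as soon as, at the two endpoints
`x = u, v`,
  `∑_{f not live} ∏_{a ∈ E_L∖{m d t}} |e f − a| · |det N_f| · x^(e f) < ∏_{a ∈ E_L∖{m d t}} |m·d t − a| · |det S t| · x^(m·d t)`
(convexity transport between the endpoints).  CONCLUSION: `det F` has at most `#E_L − 1 ≤ C(#L + m − 1, m) − 1` distinct
zeros in `[u, v]` — the sharp Descartes ceiling of the LIVE SUB-PENCIL (tree `stub_descartesCeiling` for `#L` letters),
the monomials of the other letters, wherever their exponents fall (also between live ones), being paid for by the weighted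
domination instead of being counted.  Widths: `#L = 1` ⇒ no zero (dominance exclusion); `#L = 2` ⇒ `≤ m` per window
(the count of the gen-12 Rouché window law, in a real-variable currency); `#L = 3` ⇒ `≤ C(m+2,2) − 1 = m(m+3)/2`, which
three-letter symmetric pencils ATTAIN (A3, kernel for `m ≤ 6`: `ζ(m,3) = m(m+3)/2`) — so in the overlap regime symmetry
does not lower the per-window count and the law is sharp at widths 2 and 3.
RELATIVE CURRENCY (sequel file `…OverlapWindowRel`, `card_roots_Icc_le_of_liveSet_rel`): with entry bounds `|S l i j| ≤ σ l`, conditioning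
`|det S t| ≥ η·σ_t^m`, live letters `≤ M×` and outside letters `≤ ε×` the survivor letter `σ_t x^(d t)` at both endpoints,
and weight ratio `≤ Ω`, the certificate holds whenever `m!·K^m·Ω·ε·M^(m−1) < η`.
WHAT THIS IS NOT.  Inside one window the count is Descartes' for the live letters — no symmetric saving; the law is a
LOCALITY statement (disjoint windows add, each paying for its own live set), and the weights `∏|e f − a|` grow with
the exponent spread, so the separation it needs is `≍ #E_L·log(m·d_max)` in log-scale (against `m log m + log κ` for the
complex-analytic two-letter law).  [folklore] (Laguerre's method; Pólya–Szegő V.77; Leibniz bounds).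
-/

-- `Summit.ValiantsHypothesis.ValiantsHypothesis.…` repeats a component by the D-0017 layout (single-conjunct summit).
set_option linter.dupNamespace false

namespace Summit.ValiantsHypothesis.ValiantsHypothesis.Theorems.LacunarySymmetroidMatrixDescartes.Overlap

open Polynomial Finset Set
open scoped BigOperators Matrix

variable {K m : ℕ}

/-! ## §1 Live maps, live exponents, and their number -/

/-- **Count of live exponents.**  The exponents `∑ᵢ d (f i)` of the row-to-letter maps `f : Fin m → Fin K` with all values
in the live set `L` number at most `C(#L + m − 1, m)` (they factor through the multiset of values of `f`, an element of
`Sym L m`; `Sym.card_sym_eq_choose`). [folklore] -/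
theorem card_liveExps_le (d : Fin K → ℕ) (L : Finset (Fin K)) :
    ((Fintype.piFinset fun _ : Fin m => L).image (fun f : Fin m → Fin K => ∑ i, d (f i))).card ≤
      Nat.choose (L.card + m - 1) m := by
  classical
  set T : Finset ℕ := (Finset.univ : Finset (Sym {l : Fin K // l ∈ L} m)).image
    (fun s : Sym {l : Fin K // l ∈ L} m => ((s : Multiset {l : Fin K // l ∈ L}).map (fun l => d l.1)).sum) with hT
  have hsub : (Fintype.piFinset fun _ : Fin m => L).image (fun f : Fin m → Fin K => ∑ i, d (f i)) ⊆ T := by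
    intro n hn
    rw [Finset.mem_image] at hn
    obtain ⟨f, hf, rfl⟩ := hn
    rw [Fintype.mem_piFinset] at hf
    let g' : Fin m → {l : Fin K // l ∈ L} := fun i => ⟨f i, hf i⟩
    have hcard : Multiset.card (Finset.univ.val.map g') = m := by
      rw [Multiset.card_map, Finset.card_val, Finset.card_univ, Fintype.card_fin]
    rw [hT, Finset.mem_image]
    refine ⟨Sym.mk (Finset.univ.val.map g') hcard, Finset.mem_univ _, ?_⟩
    change ((Finset.univ.val.map g').map (fun l => d l.1)).sum = ∑ i, d (f i)
    rw [Multiset.map_map]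
    rfl
  calc ((Fintype.piFinset fun _ : Fin m => L).image (fun f : Fin m → Fin K => ∑ i, d (f i))).card
      ≤ T.card := Finset.card_le_card hsub
    _ ≤ (Finset.univ : Finset (Sym {l : Fin K // l ∈ L} m)).card := by rw [hT]; exact Finset.card_image_le
    _ = Nat.choose (L.card + m - 1) m := by
        rw [Finset.card_univ, Sym.card_sym_eq_choose, Fintype.card_coe]

/-- **The top live exponent is unmixed.**  If the survivor `t ∈ L` has strictly the largest exponent in `L`, a live map
`f` with `∑ᵢ d (f i) = m·d t` is the constant map `t`. [folklore] -/
theorem eq_const_of_sum_eq_top (d : Fin K → ℕ) (L : Finset (Fin K)) (t : Fin K)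
    (htop : ∀ k ∈ L, k ≠ t → d k < d t) (f : Fin m → Fin K) (hf : ∀ i, f i ∈ L)
    (hsum : ∑ i, d (f i) = m * d t) : ∀ i, f i = t := by
  have hle : ∀ i, d (f i) ≤ d t := fun i => by
    by_cases h : f i = t
    · rw [h]
    · exact (htop _ (hf i) h).le
  by_contra hcon
  push Not at hcon
  obtain ⟨i₀, hi₀⟩ := hcon
  have hlt : ∑ i, d (f i) < ∑ _i : Fin m, d t :=
    Finset.sum_lt_sum (fun i _ => hle i) ⟨i₀, Finset.mem_univ _, htop _ (hf i₀) hi₀⟩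
  rw [Finset.sum_const, Finset.card_univ, Fintype.card_fin, smul_eq_mul, hsum] at hlt
  exact lt_irrefl _ hlt

/-- **The bottom live exponent is unmixed** (mirror of `eq_const_of_sum_eq_top`). [folklore] -/
theorem eq_const_of_sum_eq_bot (d : Fin K → ℕ) (L : Finset (Fin K)) (t : Fin K)
    (hbot : ∀ k ∈ L, k ≠ t → d t < d k) (f : Fin m → Fin K) (hf : ∀ i, f i ∈ L)
    (hsum : ∑ i, d (f i) = m * d t) : ∀ i, f i = t := by
  have hle : ∀ i, d t ≤ d (f i) := fun i => by
    by_cases h : f i = t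
    · rw [h]
    · exact (hbot _ (hf i) h).le
  by_contra hcon
  push Not at hcon
  obtain ⟨i₀, hi₀⟩ := hcon
  have hlt : ∑ _i : Fin m, d t < ∑ i, d (f i) :=
    Finset.sum_lt_sum (fun i _ => hle i) ⟨i₀, Finset.mem_univ _, hbot _ (hf i₀) hi₀⟩
  rw [Finset.sum_const, Finset.card_univ, Fintype.card_fin, smul_eq_mul, ← hsum] at hlt
  exact lt_irrefl _ hlt

/-! ## §2 Leibniz bound for the row-choice determinants -/

/-- **Row-choice Leibniz bound.**  If `|S l i j| ≤ σ l` (`σ ≥ 0`), the determinant of the matrix `N_f` whose `i`-th row is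
the `i`-th row of `S (f i)` satisfies `|det N_f| ≤ m! · ∏ᵢ σ (f i)`. [folklore] -/
theorem abs_det_rowChoice_le (S : Fin K → Matrix (Fin m) (Fin m) ℝ) (σ : Fin K → ℝ)
    (hσ : ∀ l i j, |S l i j| ≤ σ l) (f : Fin m → Fin K) :
    |Matrix.det (Matrix.of fun i j => S (f i) i j)| ≤ (m.factorial : ℝ) * ∏ i, σ (f i) := by
  rw [Matrix.det_apply']
  refine (Finset.abs_sum_le_sum_abs _ _).trans ?_
  have hterm : ∀ τ : Equiv.Perm (Fin m),
      |((Equiv.Perm.sign τ : ℤ) : ℝ) * ∏ i, (Matrix.of fun i j => S (f i) i j) (τ i) i| ≤ ∏ i, σ (f i) := by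
    intro τ
    rw [abs_mul]
    have h1 : |((Equiv.Perm.sign τ : ℤ) : ℝ)| = 1 := by
      rcases Int.units_eq_one_or (Equiv.Perm.sign τ) with h | h <;> simp [h]
    rw [h1, one_mul, Finset.abs_prod]
    calc ∏ i, |(Matrix.of fun i j => S (f i) i j) (τ i) i| ≤ ∏ i, σ (f (τ i)) :=
          Finset.prod_le_prod (fun i _ => abs_nonneg _) (fun i _ => by
            simpa only [Matrix.of_apply] using hσ (f (τ i)) (τ i) i)
      _ = ∏ i, σ (f i) := Equiv.prod_comp τ (fun i => σ (f i))
  calc ∑ τ : Equiv.Perm (Fin m), |((Equiv.Perm.sign τ : ℤ) : ℝ) * ∏ i, (Matrix.of fun i j => S (f i) i j) (τ i) i|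
      ≤ ∑ _τ : Equiv.Perm (Fin m), ∏ i, σ (f i) := Finset.sum_le_sum fun τ _ => hterm τ
    _ = (m.factorial : ℝ) * ∏ i, σ (f i) := by
        rw [Finset.sum_const, Finset.card_univ, Fintype.card_perm, Fintype.card_fin, nsmul_eq_mul]

/-! ## §3 The overlap window law -/

/-- The pencil determinant as a finite sum of monomials indexed by row-to-letter maps (tree
`LowRankSector.det_pencil_eq_sum_rowChoice`, reordered as `C c · X^e`). [folklore] -/
theorem det_pencil_eq_sum_C_mul_X_pow (d : Fin K → ℕ) (S : Fin K → Matrix (Fin m) (Fin m) ℝ) :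
    Matrix.det (∑ l, ((X : ℝ[X]) ^ d l) • (S l).map C) =
      ∑ f : Fin m → Fin K, C (Matrix.det (Matrix.of fun i j => S (f i) i j)) * X ^ (∑ i, d (f i)) := by
  rw [LowRankSector.det_pencil_eq_sum_rowChoice]
  exact Finset.sum_congr rfl fun f _ => mul_comm _ _

/-- **OVERLAP WINDOW LAW (exact form).**  Let `F = ∑ₗ X^(d l) • S l` be ANY real `m × m` lacunary pencil, `L` a set of
letters (the LIVE SET of the window), `t ∈ L` a SURVIVOR letter whose pure exponent `m·d t` is unmixed among live maps
(`huniq`; e.g. `d t` strictly extreme in `L`: `eq_const_of_sum_eq_top` / `eq_const_of_sum_eq_bot`), and `A` a finite set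
of natural CUTS containing the exponent of every live map other than `f ≡ t` and not containing `m·d t` (e.g. the live
exponent set minus `m·d t`: at most `C(#L+m−1, m) − 1` cuts by `card_liveExps_le`).  If at the two endpoints `x = u, v` of
a window (`0 < u ≤ v`)
  `∑_{f not live} (∏_{a∈A} |e f − a|)·|det N_f|·x^(e f) < (∏_{a∈A} |m·d t − a|)·|det S t|·x^(m·d t)`
(`e f = ∑ᵢ d (f i)`, `N_f` the row-choice matrix), then `det F` has at most `#A` distinct zeros in `[u, v]`.
Mechanism: cut at `A` (robust Descartes rule `RobustDescartes.card_roots_Icc_le_card_cuts`): the live non-survivor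
monomials die exactly whatever their coefficients, the survivor keeps `det S t·∏(m d t − a)`, the rest is dominated on
the whole window by convexity transport between the endpoints. [folklore] -/
theorem card_roots_Icc_le_of_liveSet (d : Fin K → ℕ) (S : Fin K → Matrix (Fin m) (Fin m) ℝ)
    (L : Finset (Fin K)) (t : Fin K) (ht : t ∈ L) (A : Finset ℕ)
    (hA : ∀ f : Fin m → Fin K, (∀ i, f i ∈ L) → (∃ i, f i ≠ t) → (∑ i, d (f i)) ∈ A)
    {u v : ℝ} (hu : 0 < u) (huv : u ≤ v)
    (hdom_u : ∑ f ∈ Finset.univ.filter (fun f : Fin m → Fin K => ¬ ∀ i, f i ∈ L),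
        (∏ a ∈ A, |((∑ i, d (f i) : ℕ) : ℝ) - a|) * |Matrix.det (Matrix.of fun i j => S (f i) i j)| *
          u ^ (∑ i, d (f i))
      < (∏ a ∈ A, |((m * d t : ℕ) : ℝ) - a|) * |(S t).det| * u ^ (m * d t))
    (hdom_v : ∑ f ∈ Finset.univ.filter (fun f : Fin m → Fin K => ¬ ∀ i, f i ∈ L),
        (∏ a ∈ A, |((∑ i, d (f i) : ℕ) : ℝ) - a|) * |Matrix.det (Matrix.of fun i j => S (f i) i j)| *
          v ^ (∑ i, d (f i))
      < (∏ a ∈ A, |((m * d t : ℕ) : ℝ) - a|) * |(S t).det| * v ^ (m * d t)) :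
    ((Matrix.det (∑ l, ((X : ℝ[X]) ^ d l) • (S l).map C)).roots.toFinset.filter
        (fun x => x ∈ Icc u v)).card ≤ A.card := by
  classical
  rw [det_pencil_eq_sum_C_mul_X_pow]
  -- real cuts
  set A' : Finset ℝ := A.image (fun a : ℕ => (a : ℝ)) with hA'
  have hcardA : A'.card = A.card := Finset.card_image_of_injective _ Nat.cast_injective
  rw [← hcardA]
  -- the weights, as products over `A`
  have hW : ∀ n : ℕ, ∏ α ∈ A', ((n : ℝ) - α) = ∏ a ∈ A, ((n : ℝ) - (a : ℝ)) := fun n => by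
    rw [hA', Finset.prod_image fun a _ b _ h => Nat.cast_injective h]
  have hWabs : ∀ n : ℕ, |∏ α ∈ A', ((n : ℝ) - α)| = ∏ a ∈ A, |(n : ℝ) - a| := fun n => by
    rw [hW, Finset.abs_prod]
  -- weights of live non-survivor exponents vanish
  have hkill : ∀ f : Fin m → Fin K, (∀ i, f i ∈ L) → (∃ i, f i ≠ t) →
      ∏ α ∈ A', (((∑ i, d (f i) : ℕ) : ℝ) - α) = 0 := by
    intro f hf hne
    rw [hW]
    exact Finset.prod_eq_zero (hA f hf hne) (sub_self _)
  refine RobustDescartes.card_roots_Icc_le_card_cuts Finset.univ _ _ A' hu huv fun x hx => ?_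
  rw [RobustDescartes.eval_sum_C_mul_X_pow,
    ← Finset.sum_filter_add_sum_filter_not Finset.univ (fun f : Fin m → Fin K => ∀ i, f i ∈ L)]
  -- the live part is the survivor term
  have hconst_mem : (fun _ : Fin m => t) ∈ Finset.univ.filter (fun f : Fin m → Fin K => ∀ i, f i ∈ L) := by
    rw [Finset.mem_filter]; exact ⟨Finset.mem_univ _, fun _ => ht⟩
  have hlive : ∑ f ∈ Finset.univ.filter (fun f : Fin m → Fin K => ∀ i, f i ∈ L),
      Matrix.det (Matrix.of fun i j => S (f i) i j) * (∏ α ∈ A', (((∑ i, d (f i) : ℕ) : ℝ) - α)) *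
        x ^ (∑ i, d (f i))
      = (S t).det * (∏ α ∈ A', (((m * d t : ℕ) : ℝ) - α)) * x ^ (m * d t) := by
    rw [Finset.sum_eq_single_of_mem (fun _ : Fin m => t) hconst_mem]
    · have hNt : (Matrix.of fun i j => S ((fun _ : Fin m => t) i) i j) = S t := by
        ext i j; rfl
      have het : (∑ i : Fin m, d ((fun _ : Fin m => t) i)) = m * d t := by
        rw [Finset.sum_const, Finset.card_univ, Fintype.card_fin, smul_eq_mul]
      rw [hNt, het]
    · intro f hf hne
      rw [Finset.mem_filter] at hf
      have hne' : ∃ i, f i ≠ t := by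
        by_contra hall
        push Not at hall
        exact hne (funext hall)
      rw [hkill f hf.2 hne', mul_zero, zero_mul]
  rw [hlive]
  -- the non-live part is dominated on the whole window (transport from the endpoints)
  have hwpos : ∀ f : Fin m → Fin K,
      0 ≤ (∏ a ∈ A, |((∑ i, d (f i) : ℕ) : ℝ) - a|) * |Matrix.det (Matrix.of fun i j => S (f i) i j)| :=
    fun f => mul_nonneg (Finset.prod_nonneg fun _ _ => abs_nonneg _) (abs_nonneg _)
  have htrans := RobustDescartes.sum_mul_pow_lt_of_endpoints
    (Finset.univ.filter (fun f : Fin m → Fin K => ¬ ∀ i, f i ∈ L))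
    (fun f => (∏ a ∈ A, |((∑ i, d (f i) : ℕ) : ℝ) - a|) * |Matrix.det (Matrix.of fun i j => S (f i) i j)|)
    (fun f _ => hwpos f) (fun f => ∑ i, d (f i)) (m * d t) hu hx.1 hx.2 hdom_u hdom_v
  -- compare
  have hx0 : 0 ≤ x := hu.le.trans hx.1
  have htail : |∑ f ∈ Finset.univ.filter (fun f : Fin m → Fin K => ¬ ∀ i, f i ∈ L),
      Matrix.det (Matrix.of fun i j => S (f i) i j) * (∏ α ∈ A', (((∑ i, d (f i) : ℕ) : ℝ) - α)) *
        x ^ (∑ i, d (f i))|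
      ≤ ∑ f ∈ Finset.univ.filter (fun f : Fin m → Fin K => ¬ ∀ i, f i ∈ L),
          (∏ a ∈ A, |((∑ i, d (f i) : ℕ) : ℝ) - a|) * |Matrix.det (Matrix.of fun i j => S (f i) i j)| *
            x ^ (∑ i, d (f i)) := by
    refine (Finset.abs_sum_le_sum_abs _ _).trans (le_of_eq (Finset.sum_congr rfl fun f _ => ?_))
    rw [abs_mul, abs_mul, hWabs, abs_of_nonneg (pow_nonneg hx0 _)]
    ring
  have hsurv : |(S t).det * (∏ α ∈ A', (((m * d t : ℕ) : ℝ) - α)) * x ^ (m * d t)|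
      = (∏ a ∈ A, |((m * d t : ℕ) : ℝ) - a|) * |(S t).det| * x ^ (m * d t) := by
    rw [abs_mul, abs_mul, hWabs, abs_of_nonneg (pow_nonneg hx0 _)]
    ring
  intro h0
  -- survivor = −tail, so |survivor| ≤ weighted tail mass < |survivor|
  have h1 : (S t).det * (∏ α ∈ A', (((m * d t : ℕ) : ℝ) - α)) * x ^ (m * d t) =
      -(∑ f ∈ Finset.univ.filter (fun f : Fin m → Fin K => ¬ ∀ i, f i ∈ L),
        Matrix.det (Matrix.of fun i j => S (f i) i j) * (∏ α ∈ A', (((∑ i, d (f i) : ℕ) : ℝ) - α)) *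
          x ^ (∑ i, d (f i))) := by linarith
  have h2 : |(S t).det * (∏ α ∈ A', (((m * d t : ℕ) : ℝ) - α)) * x ^ (m * d t)| ≤
      ∑ f ∈ Finset.univ.filter (fun f : Fin m → Fin K => ¬ ∀ i, f i ∈ L),
          (∏ a ∈ A, |((∑ i, d (f i) : ℕ) : ℝ) - a|) * |Matrix.det (Matrix.of fun i j => S (f i) i j)| *
            x ^ (∑ i, d (f i)) := by
    rw [h1, abs_neg]; exact htail
  rw [hsurv] at h2
  exact absurd htrans (not_lt.2 h2)

/-! ## §4 Corollaries: the canonical cut set (top / bottom survivor), weights, and the relative currency -/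

/-- **OVERLAP WINDOW LAW, top survivor, canonical cuts.**  With `t ∈ L` of strictly largest exponent in `L` and the cuts at
ALL live exponents except `m·d t`, the window carries at most `#E_L − 1` distinct zeros, `E_L` the live exponent set —
hence at most `C(#L + m − 1, m) − 1`, the Descartes ceiling of the live sub-pencil (`card_liveExps_le`). [folklore] -/
theorem card_roots_Icc_le_of_liveSet_top (d : Fin K → ℕ) (S : Fin K → Matrix (Fin m) (Fin m) ℝ)
    (L : Finset (Fin K)) (t : Fin K) (ht : t ∈ L) (htop : ∀ k ∈ L, k ≠ t → d k < d t)
    {u v : ℝ} (hu : 0 < u) (huv : u ≤ v)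
    (hdom : ∀ x : ℝ, (x = u ∨ x = v) →
      ∑ f ∈ Finset.univ.filter (fun f : Fin m → Fin K => ¬ ∀ i, f i ∈ L),
        (∏ a ∈ ((Fintype.piFinset fun _ : Fin m => L).image (fun f : Fin m → Fin K => ∑ i, d (f i))).erase
            (m * d t), |((∑ i, d (f i) : ℕ) : ℝ) - a|) *
          |Matrix.det (Matrix.of fun i j => S (f i) i j)| * x ^ (∑ i, d (f i))
      < (∏ a ∈ ((Fintype.piFinset fun _ : Fin m => L).image (fun f : Fin m → Fin K => ∑ i, d (f i))).erase
            (m * d t), |((m * d t : ℕ) : ℝ) - a|) * |(S t).det| * x ^ (m * d t)) :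
    ((Matrix.det (∑ l, ((X : ℝ[X]) ^ d l) • (S l).map C)).roots.toFinset.filter
        (fun x => x ∈ Icc u v)).card ≤
      ((Fintype.piFinset fun _ : Fin m => L).image (fun f : Fin m → Fin K => ∑ i, d (f i))).card - 1 := by
  classical
  set E := (Fintype.piFinset fun _ : Fin m => L).image (fun f : Fin m → Fin K => ∑ i, d (f i)) with hE
  have hmem : m * d t ∈ E := by
    rw [hE, Finset.mem_image]
    refine ⟨fun _ => t, ?_, ?_⟩
    · rw [Fintype.mem_piFinset]; exact fun _ => ht
    · rw [Finset.sum_const, Finset.card_univ, Fintype.card_fin, smul_eq_mul]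
  have hcard : (E.erase (m * d t)).card = E.card - 1 := Finset.card_erase_of_mem hmem
  rw [← hcard]
  refine card_roots_Icc_le_of_liveSet d S L t ht (E.erase (m * d t)) (fun f hf hne => ?_) hu huv
    (hdom u (Or.inl rfl)) (hdom v (Or.inr rfl))
  rw [Finset.mem_erase]
  refine ⟨fun heq => ?_, ?_⟩
  · obtain ⟨i, hi⟩ := hne
    exact hi (eq_const_of_sum_eq_top d L t htop f hf heq i)
  · rw [hE, Finset.mem_image]
    exact ⟨f, by rw [Fintype.mem_piFinset]; exact hf, rfl⟩

/-- **OVERLAP WINDOW LAW, bottom survivor, canonical cuts** (mirror of `card_roots_Icc_le_of_liveSet_top`: `t ∈ L` of strictly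
smallest exponent in `L`). [folklore] -/
theorem card_roots_Icc_le_of_liveSet_bot (d : Fin K → ℕ) (S : Fin K → Matrix (Fin m) (Fin m) ℝ)
    (L : Finset (Fin K)) (t : Fin K) (ht : t ∈ L) (hbot : ∀ k ∈ L, k ≠ t → d t < d k)
    {u v : ℝ} (hu : 0 < u) (huv : u ≤ v)
    (hdom : ∀ x : ℝ, (x = u ∨ x = v) →
      ∑ f ∈ Finset.univ.filter (fun f : Fin m → Fin K => ¬ ∀ i, f i ∈ L),
        (∏ a ∈ ((Fintype.piFinset fun _ : Fin m => L).image (fun f : Fin m → Fin K => ∑ i, d (f i))).erase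
            (m * d t), |((∑ i, d (f i) : ℕ) : ℝ) - a|) *
          |Matrix.det (Matrix.of fun i j => S (f i) i j)| * x ^ (∑ i, d (f i))
      < (∏ a ∈ ((Fintype.piFinset fun _ : Fin m => L).image (fun f : Fin m → Fin K => ∑ i, d (f i))).erase
            (m * d t), |((m * d t : ℕ) : ℝ) - a|) * |(S t).det| * x ^ (m * d t)) :
    ((Matrix.det (∑ l, ((X : ℝ[X]) ^ d l) • (S l).map C)).roots.toFinset.filter
        (fun x => x ∈ Icc u v)).card ≤
      ((Fintype.piFinset fun _ : Fin m => L).image (fun f : Fin m → Fin K => ∑ i, d (f i))).card - 1 := by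
  classical
  set E := (Fintype.piFinset fun _ : Fin m => L).image (fun f : Fin m → Fin K => ∑ i, d (f i)) with hE
  have hmem : m * d t ∈ E := by
    rw [hE, Finset.mem_image]
    refine ⟨fun _ => t, ?_, ?_⟩
    · rw [Fintype.mem_piFinset]; exact fun _ => ht
    · rw [Finset.sum_const, Finset.card_univ, Fintype.card_fin, smul_eq_mul]
  have hcard : (E.erase (m * d t)).card = E.card - 1 := Finset.card_erase_of_mem hmem
  rw [← hcard]
  refine card_roots_Icc_le_of_liveSet d S L t ht (E.erase (m * d t)) (fun f hf hne => ?_) hu huv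
    (hdom u (Or.inl rfl)) (hdom v (Or.inr rfl))
  rw [Finset.mem_erase]
  refine ⟨fun heq => ?_, ?_⟩
  · obtain ⟨i, hi⟩ := hne
    exact hi (eq_const_of_sum_eq_bot d L t hbot f hf heq i)
  · rw [hE, Finset.mem_image]
    exact ⟨f, by rw [Fintype.mem_piFinset]; exact hf, rfl⟩

end Summit.ValiantsHypothesis.ValiantsHypothesis.Theorems.LacunarySymmetroidMatrixDescartes.Overlap
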